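import Mathlib.Analysis.SpecialFunctions.Integrals.Basic
import Mathlib.MeasureTheory.Integral.Pi
import Literature.NumberTheory.Transcendental.KZConstantTerm
import Literature.NumberTheory.Transcendental.KZSliceFubini
import Literature.NumberTheory.Transcendental.KZProduct
import Summits.KontsevichZagierPeriods.KontsevichZagierPeriods.Theorems.ValuedFieldSpecialisationClassLevelExpansionFibreDimOneElementaryA
import Summits.KontsevichZagierPeriods.KontsevichZagierPeriods.Theorems.ValuedFieldSpecialisationCTConstructionElementarySliceValue

/-!
# Route ValuedFieldSpecialisation — crux `ParametricLifting` (stmt-KontsevichZagierPeriods-3498),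
line `registered`/birth, stub S2a `stub_sliceValue_elementaryFamily`: THE SLICE FORMULA OF AN
ELEMENTARY DIVERGENT PRODUCT FAMILY

For `P` with coordinates `(s, u, y₁…y_b, w)`, domain `0 < s < 1`, `0 < u`, `u^q s^p < 1`,
`s ≤ y_j ≤ 1`, `w ∈ ρ.domain` and integrand `∏ 1/y_j · ρ.integrand w`, the slice over every
`s ∈ (0,1)` is `KZ.sliceValue P s = s^{-p/q} · (-log s)^b · ρ.value` (Fubini over
`vecCons u (Fin.append y w)`). Helper (`--supports`) for item stmt-KontsevichZagierPeriods-3498.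
[Kontsevich–Zagier 2001, §1.1–1.2; Comte–Lion–Rolin 2000 (the monomials)]

The Fubini computation itself is the tree lemma `sliceValue_elementary` (file
`ValuedFieldSpecialisationCTConstructionElementarySliceValue`, helper of the sibling crux
`CTConstruction`): peel `u` along the measure-preserving `(t, x) ↦ vecCons t x`, split `(y, w)`
along `KZ.appendMeasurableEquiv`, `∫_0^{s^{-p/q}} du = s^{-p/q}`, `∫_{[s,1]ᵇ} ∏ dy_j/y_j = (-log s)ᵇ`.
This file only restates it in the exponent normal form `s ^ (-(p / q))` registered by the line
(`neg_div`). Deliberately NOT here: anything about the divergent net (stubs S2b, S2c).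
-/

noncomputable section

namespace Summit.KontsevichZagierPeriods.ValuedFieldSpecialisation

open MeasureTheory Set Filter
open scoped Topology
open Literature.NumberTheory.Transcendental

/-- **Slice formula of an elementary divergent product family.** For `P` of dimension
`b + d + 2` with coordinates `(s, u, y₁…y_b, w₁…w_d)`, domain `0 < s < 1`, `0 < u`,
`u^q s^p < 1`, `s ≤ y_j ≤ 1`, `w ∈ ρ.domain` and integrand `∏ⱼ y_j⁻¹ · ρ.integrand w` (`0 < q`),
the slice over EVERY `s ∈ (0, 1)` is `KZ.sliceValue P s = s^{-p/q} · (-log s)ᵇ · ρ.value`: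
Fubini along `(u, v) ↦ vecCons u v` (the `u`-integral is `∫_0^{s^{-p/q}} du = s^{-p/q}`, as
`u^q s^p < 1 ↔ u < s^{-p/q}` for `u > 0`), then along `(y, w) ↦ Fin.append y w`
(`∫_{[s,1]ᵇ} ∏ dy_j / y_j = (-log s)ᵇ`) — the tree lemma `sliceValue_elementary`, with the
exponent rewritten by `neg_div`. These are the divergent log-power monomials of the net of a
fibred relation in the crux `ParametricLifting` (Kontsevich–Zagier 2001, §1.1–1.2;
Comte–Lion–Rolin 2000, Thm. 1 for the shape of the monomials). [folklore] -/
theorem stub_sliceValue_elementaryFamily :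
    ∀ (p q b d : ℕ) (ρ : KZ.IntegralRep d) (P : KZ.IntegralRep (b + d + 1 + 1)), 0 < q → P.domain = {z | ∃ (s u : ℝ) (y : Fin b → ℝ) (w : Fin d → ℝ), z = Matrix.vecCons s (Matrix.vecCons u (Fin.append y w)) ∧ 0 < s ∧ s < 1 ∧ 0 < u ∧ u ^ q * s ^ p < 1 ∧ (∀ j, s ≤ y j ∧ y j ≤ 1) ∧ w ∈ ρ.domain} → (P.integrand = fun z => (∏ j : Fin b, (z (Fin.castAdd d j).succ.succ)⁻¹) * ρ.integrand (fun l : Fin d => z (Fin.natAdd b l).succ.succ)) → ∀ s ∈ Set.Ioo (0 : ℝ) 1, KZ.sliceValue P s = s ^ (-(p / q : ℝ)) * (-Real.log s) ^ b * ρ.value := by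
  intro p q b d ρ P hq hdom hint s hs
  rw [sliceValue_elementary ρ P hq hdom hint hs, neg_div]

end Summit.KontsevichZagierPeriods.ValuedFieldSpecialisation
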